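import Mathlib
import HarnessLib
import Literature.AlgebraicGeometry.Tropical.TorusCycles

/-!
# Effective tropical cycles on a tropical torus — the empty cycle, non-emptiness of the carrier

Companion to `Literature.AlgebraicGeometry.Tropical.TorusCycles` [cite: MikhalkinZharkov2014Eigenwave,
Def. 4.2, Prop. 4.3; Zharkov2020TropicalWeil §2]. The presentation `TropicalTorusCycle g p Q` of an
effective tropical `p`-cycle on `ℝᵍ / Q·ℤᵍ` (finitely many weighted framed lattice simplices + a
facet-class balancing certificate) always contains the **empty cycle** (no cells, no facet classes:
the zero cycle), so the carrier type is non-empty for every `g`, `p`, `Q` — statements of the form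
`∀ Z : TropicalTorusCycle g p Q, …` are never vacuous for emptiness reasons — and the empty cycle has
cycle class `0` and Weil functional `0`. (The geometric content of such statements lies in the
non-trivial cycles, e.g. complete intersections of tropical theta divisors.)
-/

namespace Literature.AlgebraicGeometry.Tropical

open scoped BigOperators Matrix

namespace TropicalTorusCycle

variable {g p : ℕ} {Q : Matrix (Fin g) (Fin g) ℝ}

/-- The **empty (zero) effective tropical `p`-cycle** on `ℝᵍ / Q·ℤᵍ`: no cells and no facet classes;
the closedness certificate is vacuous. [cite: MikhalkinZharkov2014Eigenwave, Def. 4.2] -/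
def empty (g p : ℕ) (Q : Matrix (Fin g) (Fin g) ℝ) : TropicalTorusCycle g p Q where
  numCells := 0
  cell := Fin.elim0
  numFacetClasses := 0
  refFacet := Fin.elim0
  facetClass := Fin.elim0
  facetPerm := Fin.elim0
  facetShift := Fin.elim0
  facet_eq := fun σ => Fin.elim0 σ
  balanced := fun f => Fin.elim0 f

/-- The carrier of effective tropical `p`-cycles on `ℝᵍ / Q·ℤᵍ` is non-empty (it contains the empty
cycle), for every `g`, `p`, `Q`. [cite: MikhalkinZharkov2014Eigenwave, Def. 4.2] -/
instance instNonempty (g p : ℕ) (Q : Matrix (Fin g) (Fin g) ℝ) : Nonempty (TropicalTorusCycle g p Q) :=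
  ⟨empty g p Q⟩

/-- … and inhabited, with the empty cycle as default. [cite: MikhalkinZharkov2014Eigenwave, Def. 4.2] -/
instance instInhabited (g p : ℕ) (Q : Matrix (Fin g) (Fin g) ℝ) : Inhabited (TropicalTorusCycle g p Q) :=
  ⟨empty g p Q⟩

/-- The empty cycle has no cells. [cite: MikhalkinZharkov2014Eigenwave, Def. 4.2] -/
@[simp] theorem numCells_empty (g p : ℕ) (Q : Matrix (Fin g) (Fin g) ℝ) : (empty g p Q).numCells = 0 := rfl

/-- The empty cycle has cycle class `0` (the empty sum). [cite: MikhalkinZharkov2014Eigenwave, Prop. 4.3] -/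
@[simp] theorem cyc_empty (g p : ℕ) (Q : Matrix (Fin g) (Fin g) ℝ) : (empty g p Q).cyc = 0 := by
  funext S S'
  simp [cyc, empty]

end TropicalTorusCycle

/-- The empty cycle has Weil functional `0` (the empty sum). [cite: Zharkov2020TropicalWeil, §3] -/
@[simp] theorem weilFunctional_empty (n : ℕ) (Q : Matrix (Fin (2 * n)) (Fin (2 * n)) ℝ) :
    weilFunctional (TropicalTorusCycle.empty (2 * n) n Q) = 0 := by
  simp [weilFunctional, TropicalTorusCycle.empty]

end Literature.AlgebraicGeometry.Tropical
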